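import Literature.MathematicalPhysics.QuantumFieldTheory.Balaban1983to89.B9Thm315WholeBlocksRect

/-!
# `Balaban1983to89.B9Thm315WholeSectERepOn` — [B9] Theorem 3.15 (p. 432) through the (3.185) slot with the decay of `QG̃₂Q*` asked ON Λ ONLY (print:
# «y, y′ ∈ Λ»), and the (3.185) slot ∕ the outer locality ∕ the middle decay FREE at members without Λ-bonds (the diagonal members)

T. Bałaban, *Propagators for lattice gauge theories in a background field*, Commun. Math. Phys. **99** (1985) 389–434
[`Balaban1985BackgroundPropagators`, "B9"].

statement-level skeleton of published theorems with citation tags; proofs where landed; nothing here is a claim about the Yang–Mills mass gap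

THE PRINTED LOCUS (verbatim, p. 432 [PDF 44]).  *"For Mα₀ sufficiently small the propagator C^{(k)}(Λ) is given by the formula (3.185), and satisfies the bound
|C^{(k)}(Λ; y, y′)| ≤ B₀e^{−δ₀|y−y′|}, y, y′ ∈ Λ (3.187)"*; p. 427: *"We need operators with Dirichlet boundary conditions outside some domain Λ of the unit
lattice"*, *"g is an arbitrary Lie algebra valued function defined at bonds of Λ"*.

THE POINT.  The seat's `B9Thm315WholeSectERep` (p503636) proves row 24 through the (3.185) slot from `LocalOuterY` and the decay `DecayMidY x 𝔏 𝔢 B₁ U δ` of the blocks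
of the middle factor `Q(U)G̃₂(U)Q*(U)` for ALL pairs of index bonds.  Print's objects live on the bonds of Λ (Dirichlet outside): in `C^{(k)}(Λ) = P_Λ(1 + Dμ)P_Λ ·
QG̃₂Q* · P_Λ(1 + μ*D*)P_Λ` the middle factor is read between the two `P_Λ`, so only its blocks between Λ-bonds matter.  THIS FILE sharpens the face accordingly:
§1 the absorption identities `P_Λ(1 + Dμ)P_Λ · P_Λ = P_Λ(1 + Dμ)P_Λ`, `P_Λ · P_Λ(1 + μ*D*)P_Λ = …`, hence `rhs3185Y = outerLY · (P_Λ · midSY · P_Λ) · outerRY`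
(`rhs3185Y_eq_sandwich`) and the block identity with the SANDWICHED middle factor; §2 the Λ-restricted schema ★ `DecayMidOnY x 𝔏 𝔢 B₁ U δ` (`∀ p q ∈ Λ`, weaker than
`DecayMidY`; `decayMidOnY_of_decayMidY`), ★ `bound3187_sectE_of_3185_on` ((3.185) + `LocalOuterY … U` + `DecayMidOnY` ⇒ (3.187), same constants); §3 MEMBERS WITHOUT
Λ-BONDS (every diagonal member `MemberY.diag`, `B9PinGeometryKLevelV1.not_inΛY_diag`): `secΛY_eq_zero`, ★ `givenBy3185Y_of_forall_not_inΛ` (both sides of (3.185) VANISH —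
the pinned slot holds OUTRIGHT there, for every `U` and all letters), `localOuterY_of_forall_not_inΛ`, `decayMidOnY_of_forall_not_inΛ` (vacuous), and the `diag`
corollaries; §4 the family face ★★ `thm315FullPrinted_sectE_of_3185_on` at `operatorLayerYSectE` (displayed under the prefix: `givenBy3185Y ∧ hasRWExpCY (𝔴 x) U δ₁ ∧
LocalOuterY x (𝔢 x) r m_E m_F U ∧ DecayMidOnY x (𝔏 x) (𝔢 x) B₁ U δ₁`), record faces `t315_opsYSectE_of_3185_on`, `t315_opsYOfRecordV4E_of_3185_on`; §6 THE HONESTY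
GUARD (`outerLY_flat`, `midSY_flat`, `localOuterY_flat`, `decayMidOnY_flat`, ★ `hyps3185_flat`): at def-Y's FLAT Sect. E letters the three (3.185)-side conjuncts hold
for every `U` — the schema is inhabited by the typing and carries content exactly with genuine letters (as def-Y's `t315_opsYOfRecordES_flat`).

HONEST SCOPE.  Count-neutral kernel bookkeeping (a weaker displayed hypothesis and the vacuous cases); the (3.185) identity at members WITH Λ-bonds, the decay of
`QG̃₂Q*` between Λ-bonds (G-B9-10), the outer locality and the expansion clause stay DISPLAYED.  Nothing of print asserted; NOT a node discharge (N06 unmoved), NOT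
summit progress; one finite lattice programme at fixed ε; nothing continuum ∕ ℝ⁴ ∕ OS ∕ mass gap ∕ Clay.  Cell `pub-ymgap` (D-0062), node N06 [B9], bundle F8 row 24
(successor file), seat `pub-ymgap-dag-n06-m` (g4), 2026-08-27.  Imports the seat's `B9Thm315WholeBlocksRect`; nothing restated.  Net new unproved facts: 0.
-/

noncomputable section

namespace Literature.MathematicalPhysics.QuantumFieldTheory.Balaban1983to89.B9Thm315WholeSectERepOn

open B9 Node00
open B4Sect5Torus (IsPseudoDist)
open B6KLevelCensusIndexV1 (KIdx)
open B9PinMembersKLevelV1 (MemberY geo9Y bg9Y)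
open B9PinCarriersKLevelV1 (OperatorLayerY)
open B9PinGeometryKLevelV1 (inΛY unitDistY c35Y not_inΛY_diag)
open B7Prop2SpecialUnitary (specialUnitaryUnits)
open B9Thm315WholeBlocks (blockCLM blockMat blockMat_apply blockCLM_apply)
open B9Thm315WholeBlocksRect (blockCLM_sec_sandwich blockCLM_ne_zero_of_sec_sandwich)
open B9Thm315WholeSectERep (outerLY midSY outerRY rhs3185Y_eq_mul blockMat_mul abs_ker_CkY_le op_dressed_decay LocalOuterY DecayMidY
  blockCLM_outer_eq_zero_off)
open B9Thm314WholePinGeometry (isPseudoDist_unitDistY)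
open scoped Matrix

variable {d ℓ : ℕ} {hd : 1 ≤ d + 1} {hL : Odd (ℓ + 1) ∧ 1 < ℓ + 1} {b₀ b₁ : ℝ} {Mstar : ℕ}
variable {𝔸 : Type} [NormedRing 𝔸] [NormedAlgebra ℂ 𝔸] [CompleteSpace 𝔸]

/-! ## §1 The middle factor is read between the two `P_Λ` -/

section Sandwich

variable {x : MemberY d ℓ hd hL b₀ b₁ Mstar} (𝔏 : CovLettersY 𝔸 x) (𝔢 : SectELettersY 𝔸 x)

/-- `P_Λ(1 + Dμ)P_Λ · P_Λ = P_Λ(1 + Dμ)P_Λ`. [cite: Balaban1985BackgroundPropagators, (3.185) p.432, p.427 (Dirichlet outside Λ), bookkeeping] -/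
theorem outerLY_mul_secΛY (U : CfgY 𝔸 x.toKIdx) : outerLY x 𝔢 U * secΛY 𝔸 x = outerLY x 𝔢 U :=
  mul_secΛY_mul_secΛY x _

/-- `P_Λ · P_Λ(1 + μ*D*)P_Λ = P_Λ(1 + μ*D*)P_Λ`. [cite: Balaban1985BackgroundPropagators, (3.185) p.432, p.427, bookkeeping] -/
theorem secΛY_mul_outerRY (U : CfgY 𝔸 x.toKIdx) : secΛY 𝔸 x * outerRY x 𝔢 U = outerRY x 𝔢 U := by
  show secΛY 𝔸 x * (secΛY 𝔸 x * (1 + 𝔢.muT U ∘ₗ 𝔢.DbarT U) * secΛY 𝔸 x) = _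
  rw [← mul_assoc, ← mul_assoc, secΛY_idem]
  rfl

/-- ★ **THE (3.185) EXPRESSION WITH THE MIDDLE FACTOR SANDWICHED**: `rhs3185Y = P_Λ(1 + Dμ)P_Λ · (P_Λ · QG̃₂Q* · P_Λ) · P_Λ(1 + μ*D*)P_Λ` — only the blocks of
`QG̃₂Q*` between bonds of Λ enter. [cite: Balaban1985BackgroundPropagators, (3.185) p.432, Thm 3.15 p.432 («y, y′ ∈ Λ»)] -/
theorem rhs3185Y_eq_sandwich (U : CfgY 𝔸 x.toKIdx) :
    rhs3185Y x 𝔏 𝔢 U = outerLY x 𝔢 U * (secΛY 𝔸 x * midSY x 𝔏 𝔢 U * secΛY 𝔸 x) * outerRY x 𝔢 U := by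
  have h : outerLY x 𝔢 U * (secΛY 𝔸 x * midSY x 𝔏 𝔢 U * secΛY 𝔸 x) * outerRY x 𝔢 U =
      (outerLY x 𝔢 U * secΛY 𝔸 x) * midSY x 𝔏 𝔢 U * (secΛY 𝔸 x * outerRY x 𝔢 U) := by simp only [mul_assoc]
  rw [h, outerLY_mul_secΛY, secΛY_mul_outerRY, rhs3185Y_eq_mul]

variable [FiniteDimensional ℂ 𝔸]

/-- ★ the pinned (3.185) identity gives the block identity with the SANDWICHED middle factor. [cite: Balaban1985BackgroundPropagators, Thm 3.15 (3.185) p.432] -/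
theorem blockMat_CkY_of_givenBy3185Y_sandwich {U : CfgY 𝔸 x.toKIdx} (h : givenBy3185Y x 𝔏 𝔢 U) :
    blockMat (CkY x 𝔏 𝔢 U) =
      blockMat (outerLY x 𝔢 U) * blockMat (secΛY 𝔸 x * midSY x 𝔏 𝔢 U * secΛY 𝔸 x) * blockMat (outerRY x 𝔢 U) := by
  rw [(givenBy3185Y_iff U).1 h, rhs3185Y_eq_sandwich, blockMat_mul, blockMat_mul]

end Sandwich

/-! ## §2 The Λ-restricted decay of the middle factor and (3.185) ⇒ (3.187) from it -/

section OnLambda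

variable (x : MemberY d ℓ hd hL b₀ b₁ Mstar) (𝔏 : CovLettersY 𝔸 x) (𝔢 : SectELettersY 𝔸 x) [FiniteDimensional ℂ 𝔸]

/-- ★ **THE LOCATED DECAY OF `QG̃₂Q*` BETWEEN BONDS OF Λ at `(U, δ)`**: `‖block(Q(U)G̃₂(U)Q*(U))(p, q)‖ ≤ B₁e^{−δ|p−q|}` for `p, q ∈ Λ` (print's «y, y′ ∈ Λ»; weaker
than `DecayMidY`, which asks it for all index bonds).  A hypothesis schema (G-B9-10). [cite: Balaban1985BackgroundPropagators, (3.186) p.432, Thm 3.15 (3.187) p.432] -/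
def DecayMidOnY (B₁ : ℝ) (U : CfgY 𝔸 x.toKIdx) (δ : ℝ) : Prop :=
  ∀ p q : IBondY x.toKIdx, inΛY x p → inΛY x q → ‖blockCLM (midSY x 𝔏 𝔢 U) p q‖ ≤ B₁ * Real.exp (-(δ * unitDistY x p q))

variable {x 𝔏 𝔢}

/-- the schema unfolded. [cite: Balaban1985BackgroundPropagators, (3.186) p.432, bookkeeping] -/
theorem decayMidOnY_iff (B₁ : ℝ) (U : CfgY 𝔸 x.toKIdx) (δ : ℝ) :
    DecayMidOnY x 𝔏 𝔢 B₁ U δ ↔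
      ∀ p q : IBondY x.toKIdx, inΛY x p → inΛY x q → ‖blockCLM (midSY x 𝔏 𝔢 U) p q‖ ≤ B₁ * Real.exp (-(δ * unitDistY x p q)) := Iff.rfl

/-- the all-pairs decay implies the Λ-restricted one. [cite: Balaban1985BackgroundPropagators, (3.186) p.432, bookkeeping] -/
theorem decayMidOnY_of_decayMidY {B₁ : ℝ} {U : CfgY 𝔸 x.toKIdx} {δ : ℝ} (h : DecayMidY x 𝔏 𝔢 B₁ U δ) : DecayMidOnY x 𝔏 𝔢 B₁ U δ :=
  fun p q _ _ => h p q

/-- the blocks of the sandwiched middle factor decay for ALL pairs once they decay between Λ-bonds (off Λ × Λ they vanish; `B₁ ≥ 0`).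
[cite: Balaban1985BackgroundPropagators, (3.186) p.432, p.427 (Dirichlet outside Λ), bookkeeping] -/
theorem norm_blockCLM_sandwich_mid_le {B₁ : ℝ} {U : CfgY 𝔸 x.toKIdx} {δ : ℝ} (hB₁ : 0 ≤ B₁) (h : DecayMidOnY x 𝔏 𝔢 B₁ U δ) (p q : IBondY x.toKIdx) :
    ‖blockCLM (secΛY 𝔸 x * midSY x 𝔏 𝔢 U * secΛY 𝔸 x) p q‖ ≤ B₁ * Real.exp (-(δ * unitDistY x p q)) := by
  have hs := blockCLM_sec_sandwich (inΛY x) (midSY x 𝔏 𝔢 U) p q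
  rw [show secY 𝔸 (inΛY x) = secΛY 𝔸 x from rfl] at hs
  rw [hs]
  split_ifs with hpq
  · exact h p q hpq.1 hpq.2
  · rw [norm_zero]; positivity

/-- ★ **(3.185) ⇒ (3.187) AT ONE CONFIGURATION WITH THE Λ-RESTRICTED MIDDLE DECAY**: `givenBy3185Y` + `LocalOuterY … U` + `DecayMidOnY … B₁ U δ` ⇒
`|C^{(k)}(Λ; U; y, y′)| ≤ B₁e^{2δr}m_Em_F·e^{−δ|y−y′|}` for all index bonds (the constants of `B9Thm315WholeSectERep.bound3187_sectE_of_3185`).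
[cite: Balaban1985BackgroundPropagators, Thm 3.15 (3.185)–(3.187) p.432, (3.169) p.430] -/
theorem bound3187_sectE_of_3185_on {G : Subgroup 𝔸ˣ} {B₁ δ r mE mF : ℝ} (hB₁ : 0 ≤ B₁) (hδ : 0 ≤ δ) {U : (bg9Y 𝔸 G x).Cfg}
    (h85 : givenBy3185Y x 𝔏 𝔢 U) (hLoc : LocalOuterY x 𝔢 r mE mF U) (hS : DecayMidOnY x 𝔏 𝔢 B₁ U δ) (y y' : (geo9Y x).Site) :
    |(siteKernelOfOp x.toKIdx (bg9Y 𝔸 G x) (fun U => U) (CkY x 𝔏 𝔢) id id).ker U y y'| ≤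
      B₁ * Real.exp (2 * δ * r) * mE * mF * Real.exp (-(δ * unitDistY x y y')) := by
  refine (abs_ker_CkY_le x 𝔏 𝔢 U y y').trans ?_
  rw [blockMat_CkY_of_givenBy3185Y_sandwich 𝔏 𝔢 h85]
  exact op_dressed_decay (unitDistY x) (isPseudoDist_unitDistY x) _ _ _ hB₁ hδ (norm_blockCLM_sandwich_mid_le hB₁ hS)
    hLoc.rangeL hLoc.rowMassL hLoc.rangeR hLoc.colMassR y y'

end OnLambda

/-! ## §3 Members without Λ-bonds (the diagonal members): the (3.185) slot, the outer locality and the middle decay are FREE -/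

section NoLambda

variable {x : MemberY d ℓ hd hL b₀ b₁ Mstar} (𝔏 : CovLettersY 𝔸 x) (𝔢 : SectELettersY 𝔸 x)

omit [CompleteSpace 𝔸] in
/-- a sector projection onto an EMPTY sector is `0`. [cite: Balaban1985BackgroundPropagators, p.427 (Dirichlet outside Λ), bookkeeping] -/
theorem secY_eq_zero_of_forall_not {X : Type} {S : X → Prop} (h : ∀ z, ¬ S z) : secY 𝔸 S = 0 := by
  ext f z
  exact secY_apply_of_not (h z) f

omit [CompleteSpace 𝔸] in
/-- at a member WITHOUT Λ-bonds `P_Λ = 0`. [cite: Balaban1985BackgroundPropagators, p.427, bookkeeping] -/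
theorem secΛY_eq_zero (hΛ : ∀ b : IBondY x.toKIdx, ¬ inΛY x b) : secΛY 𝔸 x = 0 := secY_eq_zero_of_forall_not hΛ

/-- … hence `C^{(k)}(Λ; U) = 0` (its range is `P_Λ`-supported). [cite: Balaban1985BackgroundPropagators, (3.158) p.428, bookkeeping] -/
theorem CkY_eq_zero_of_forall_not_inΛ (hΛ : ∀ b : IBondY x.toKIdx, ¬ inΛY x b) (U : CfgY 𝔸 x.toKIdx) : CkY x 𝔏 𝔢 U = 0 := by
  rw [← secΛY_mul_CkY U, secΛY_eq_zero hΛ, zero_mul]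

/-- … and the (3.185) expression is `0` too. [cite: Balaban1985BackgroundPropagators, (3.185) p.432, bookkeeping] -/
theorem rhs3185Y_eq_zero_of_forall_not_inΛ (hΛ : ∀ b : IBondY x.toKIdx, ¬ inΛY x b) (U : CfgY 𝔸 x.toKIdx) : rhs3185Y x 𝔏 𝔢 U = 0 := by
  rw [← secΛY_mul_rhs3185Y U, secΛY_eq_zero hΛ, zero_mul]

/-- ★ **AT A MEMBER WITHOUT Λ-BONDS THE PINNED (3.185) SLOT HOLDS OUTRIGHT**, for every `U` and all letters (both sides vanish) — so the knit's displayed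
(3.185) hypothesis has content only at members with Λ-bonds. [cite: Balaban1985BackgroundPropagators, Thm 3.15 (3.185) p.432, bookkeeping] -/
theorem givenBy3185Y_of_forall_not_inΛ (hΛ : ∀ b : IBondY x.toKIdx, ¬ inΛY x b) (U : CfgY 𝔸 x.toKIdx) : givenBy3185Y x 𝔏 𝔢 U := by
  rw [givenBy3185Y_iff, CkY_eq_zero_of_forall_not_inΛ 𝔏 𝔢 hΛ, rhs3185Y_eq_zero_of_forall_not_inΛ 𝔏 𝔢 hΛ]

variable [FiniteDimensional ℂ 𝔸]

/-- at a member without Λ-bonds the outer locality holds for any `r` and any masses `m_E, m_F ≥ 0` (all blocks of the outer factors vanish).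
[cite: Balaban1985BackgroundPropagators, (3.169) p.430, bookkeeping] -/
theorem localOuterY_of_forall_not_inΛ (hΛ : ∀ b : IBondY x.toKIdx, ¬ inΛY x b) {r mE mF : ℝ} (hmE : 0 ≤ mE) (hmF : 0 ≤ mF)
    (U : CfgY 𝔸 x.toKIdx) : LocalOuterY x 𝔢 r mE mF U := by
  have h0 : ∀ p q : IBondY x.toKIdx, blockCLM (outerLY x 𝔢 U) p q = 0 ∧ blockCLM (outerRY x 𝔢 U) p q = 0 :=
    fun p q => blockCLM_outer_eq_zero_off U (fun h => hΛ p h.1)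
  refine ⟨fun p q h => absurd (h0 p q).1 h, fun p => ?_, fun q p h => absurd (h0 q p).2 h, fun p => ?_⟩
  · rw [Finset.sum_eq_zero fun q _ => by rw [(h0 p q).1, norm_zero]]; exact hmE
  · rw [Finset.sum_eq_zero fun q _ => by rw [(h0 q p).2, norm_zero]]; exact hmF

/-- at a member without Λ-bonds the Λ-restricted middle decay is vacuous. [cite: Balaban1985BackgroundPropagators, (3.186) p.432, bookkeeping] -/
theorem decayMidOnY_of_forall_not_inΛ (hΛ : ∀ b : IBondY x.toKIdx, ¬ inΛY x b) (B₁ : ℝ) (U : CfgY 𝔸 x.toKIdx) (δ : ℝ) :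
    DecayMidOnY x 𝔏 𝔢 B₁ U δ := fun p _ hp _ => absurd hp (hΛ p)

end NoLambda

section Diagonal

variable (i : KIdx d ℓ hd hL b₀ b₁) (hcf : i.cf = (((ℓ + 1 : ℕ) : ℝ)) ^ i.k) (hM : Mstar ≤ (ℓ + 1) * i.Mh)

/-- ★ **AT EVERY DIAGONAL MEMBER (`Λ = ∅`) the (3.185) slot holds outright.** [cite: Balaban1985BackgroundPropagators, Thm 3.15 (3.185) p.432, bookkeeping] -/
theorem givenBy3185Y_diag (𝔏 : CovLettersY 𝔸 (MemberY.diag i hcf hM : MemberY d ℓ hd hL b₀ b₁ Mstar))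
    (𝔢 : SectELettersY 𝔸 (MemberY.diag i hcf hM : MemberY d ℓ hd hL b₀ b₁ Mstar)) (U : CfgY 𝔸 i) :
    givenBy3185Y (MemberY.diag i hcf hM : MemberY d ℓ hd hL b₀ b₁ Mstar) 𝔏 𝔢 U :=
  givenBy3185Y_of_forall_not_inΛ 𝔏 𝔢 (not_inΛY_diag (Mstar := Mstar) i hcf hM) U

variable [FiniteDimensional ℂ 𝔸]

/-- … and so do the outer locality (any `r`, masses `≥ 0`) and the Λ-restricted middle decay. [cite: Balaban1985BackgroundPropagators, (3.169) p.430, (3.186) p.432, bookkeeping] -/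
theorem localOuterY_decayMidOnY_diag (𝔏 : CovLettersY 𝔸 (MemberY.diag i hcf hM : MemberY d ℓ hd hL b₀ b₁ Mstar))
    (𝔢 : SectELettersY 𝔸 (MemberY.diag i hcf hM : MemberY d ℓ hd hL b₀ b₁ Mstar)) {r mE mF : ℝ} (hmE : 0 ≤ mE) (hmF : 0 ≤ mF) (B₁ δ : ℝ)
    (U : CfgY 𝔸 i) :
    LocalOuterY (MemberY.diag i hcf hM : MemberY d ℓ hd hL b₀ b₁ Mstar) 𝔢 r mE mF U ∧
      DecayMidOnY (MemberY.diag i hcf hM : MemberY d ℓ hd hL b₀ b₁ Mstar) 𝔏 𝔢 B₁ U δ :=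
  ⟨localOuterY_of_forall_not_inΛ 𝔢 (not_inΛY_diag (Mstar := Mstar) i hcf hM) hmE hmF U,
    decayMidOnY_of_forall_not_inΛ 𝔏 𝔢 (not_inΛY_diag (Mstar := Mstar) i hcf hM) B₁ U δ⟩

end Diagonal

/-! ## §4 ROW 24 through the (3.185) slot with the Λ-restricted middle decay -/

section Layer

variable [FiniteDimensional ℂ 𝔸] {G : Subgroup 𝔸ˣ}

/-- ★★ **THEOREM 3.15 AS THE WHOLE PRINTED LEAF AT THE SECT. E LAYER THROUGH THE (3.185) SLOT, MIDDLE DECAY ON Λ ONLY**: as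
`B9Thm315WholeSectERep.thm315FullPrinted_sectE_of_3185` with `DecayMidY` weakened to `DecayMidOnY` (print's «y, y′ ∈ Λ»); at members without Λ-bonds every
conjunct of `h` but the expansion clause is free (§3).  OUTPUT δ₀ = δ₁, a₀, B₀ = B₁e^{2δ₁r}m_Em_F.  NOT a node discharge.
[cite: Balaban1985BackgroundPropagators, Thm 3.15 (3.185)–(3.187) p.432, (3.169) p.430, (3.186) p.432] -/
theorem thm315FullPrinted_sectE_of_3185_on
    (ops : ∀ x : MemberY d ℓ hd hL b₀ b₁ Mstar, OperatorLayerY d ℓ hd hL b₀ b₁ Mstar 𝔸 G x)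
    (𝔏 : ∀ x : MemberY d ℓ hd hL b₀ b₁ Mstar, CovLettersY 𝔸 x) (𝔢 : ∀ x : MemberY d ℓ hd hL b₀ b₁ Mstar, SectELettersY 𝔸 x)
    (𝔴 : ∀ x : MemberY d ℓ hd hL b₀ b₁ Mstar, RWLettersEY 𝔸 G x)
    {a₀ δ₁ B₁ r mE mF : ℝ} (ha₀ : 0 < a₀) (hδ₁ : 0 < δ₁) (hB₁ : 0 < B₁) (hmE : 0 < mE) (hmF : 0 < mF)
    (h : ∀ (x : MemberY d ℓ hd hL b₀ b₁ Mstar) (α₀ : ℝ), 0 < α₀ → (geo9Y x).M * α₀ ≤ a₀ →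
      ∀ U : (bg9Y 𝔸 G x).Cfg, (bg9Y 𝔸 G x).Reg335 c35Y α₀ U → (bg9Y 𝔸 G x).Reg336 c35Y α₀ U →
        givenBy3185Y x (𝔏 x) (𝔢 x) U ∧ hasRWExpCY (𝔴 x) U δ₁ ∧
          LocalOuterY x (𝔢 x) r mE mF U ∧ DecayMidOnY x (𝔏 x) (𝔢 x) B₁ U δ₁) :
    B9.Thm315FullPrinted c35Y geo9Y (bg9Y 𝔸 G)
      (fun x => (operatorLayerYSectE 𝔸 G x (ops x) (𝔏 x) (𝔢 x) (𝔴 x)).Ck) inΛY unitDistY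
      (fun x => (operatorLayerYSectE 𝔸 G x (ops x) (𝔏 x) (𝔢 x) (𝔴 x)).GivenBy3185)
      (fun x => (operatorLayerYSectE 𝔸 G x (ops x) (𝔏 x) (𝔢 x) (𝔴 x)).HasRWExpC) := by
  refine ⟨δ₁, a₀, B₁ * Real.exp (2 * δ₁ * r) * mE * mF, hδ₁, ha₀, by positivity, fun x α₀ hα hMa U hU hU' => ?_⟩
  obtain ⟨h85, hRW, hLoc, hS⟩ := h x α₀ hα hMa U hU hU'
  exact ⟨h85, hRW, fun y y' _ _ => bound3187_sectE_of_3185_on hB₁.le hδ₁.le h85 hLoc hS y y'⟩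

end Layer

/-! ## §5 Record level: at `opsYSectE` (generic) and at the v4 record `opsYOfRecordV4E` -/

section Record

open scoped Matrix.Norms.L2Operator

variable (N : ℕ) (θ : Stage3Params) (Mstar : ℕ)

/-- ★★ **ROW 24 (`t315`) AT THE SECT. E LAYER FAMILY `opsYSectE N θ M⋆ ops 𝔏 𝔢 𝔴` THROUGH THE (3.185) SLOT, MIDDLE DECAY ON Λ ONLY** (generic base family and letters).
[cite: Balaban1985BackgroundPropagators, Thm 3.15 (3.185)–(3.187) p.432] -/
theorem t315_opsYSectE_of_3185_on (ops : OpsY N θ Mstar) (𝔏 : LettersY N θ Mstar) (𝔢 : SectEY N θ Mstar) (𝔴 : RWEY N θ Mstar)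
    {a₀ δ₁ B₁ r mE mF : ℝ} (ha₀ : 0 < a₀) (hδ₁ : 0 < δ₁) (hB₁ : 0 < B₁) (hmE : 0 < mE) (hmF : 0 < mF)
    (h : ∀ (x : MemberY θ.d₆ θ.ℓ₆ θ.hd' θ.hL' θ.b₀ θ.b₁ Mstar) (α₀ : ℝ), 0 < α₀ → (geo9Y x).M * α₀ ≤ a₀ →
      ∀ U : (bg9Y (Matrix (Fin N) (Fin N) ℂ) (specialUnitaryUnits (Fin N)) x).Cfg,
        (bg9Y (Matrix (Fin N) (Fin N) ℂ) (specialUnitaryUnits (Fin N)) x).Reg335 c35Y α₀ U →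
        (bg9Y (Matrix (Fin N) (Fin N) ℂ) (specialUnitaryUnits (Fin N)) x).Reg336 c35Y α₀ U →
          givenBy3185Y x (𝔏 x) (𝔢 x) U ∧ hasRWExpCY (𝔴 x) U δ₁ ∧
            LocalOuterY x (𝔢 x) r mE mF U ∧ DecayMidOnY x (𝔏 x) (𝔢 x) B₁ U δ₁) :
    B9.Thm315FullPrinted c35Y geo9Y (bg9Y (Matrix (Fin N) (Fin N) ℂ) (specialUnitaryUnits (Fin N)))
      (fun x => (opsYSectE N θ Mstar ops 𝔏 𝔢 𝔴 x).Ck) inΛY unitDistY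
      (fun x => (opsYSectE N θ Mstar ops 𝔏 𝔢 𝔴 x).GivenBy3185) (fun x => (opsYSectE N θ Mstar ops 𝔏 𝔢 𝔴 x).HasRWExpC) :=
  thm315FullPrinted_sectE_of_3185_on ops 𝔏 𝔢 𝔴 ha₀ hδ₁ hB₁ hmE hmF h

/-- ★★ **ROW 24 (`t315`) AT def-Y's v4 INSTANCE OF RECORD `opsYOfRecordV4E N θ M⋆ 𝔯 𝔢 𝔴 𝔈` THROUGH THE (3.185) SLOT, MIDDLE DECAY ON Λ ONLY** (binder VERBATIM).
[cite: Balaban1985BackgroundPropagators, Thm 3.15 (3.185)–(3.187) p.432] -/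
theorem t315_opsYOfRecordV4E_of_3185_on (𝔯 : ResY N θ Mstar) (𝔢 : SectEY N θ Mstar) (𝔴 : RWEY N θ Mstar) (𝔈 : ExpsY N θ Mstar)
    {a₀ δ₁ B₁ r mE mF : ℝ} (ha₀ : 0 < a₀) (hδ₁ : 0 < δ₁) (hB₁ : 0 < B₁) (hmE : 0 < mE) (hmF : 0 < mF)
    (h : ∀ (x : MemberY θ.d₆ θ.ℓ₆ θ.hd' θ.hL' θ.b₀ θ.b₁ Mstar) (α₀ : ℝ), 0 < α₀ → (geo9Y x).M * α₀ ≤ a₀ →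
      ∀ U : (bg9Y (Matrix (Fin N) (Fin N) ℂ) (specialUnitaryUnits (Fin N)) x).Cfg,
        (bg9Y (Matrix (Fin N) (Fin N) ℂ) (specialUnitaryUnits (Fin N)) x).Reg335 c35Y α₀ U →
        (bg9Y (Matrix (Fin N) (Fin N) ℂ) (specialUnitaryUnits (Fin N)) x).Reg336 c35Y α₀ U →
          givenBy3185Y x (lettersYOfRecordV4 N θ Mstar 𝔯 x) (𝔢 x) U ∧ hasRWExpCY (𝔴 x) U δ₁ ∧
            LocalOuterY x (𝔢 x) r mE mF U ∧ DecayMidOnY x (lettersYOfRecordV4 N θ Mstar 𝔯 x) (𝔢 x) B₁ U δ₁) :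
    B9.Thm315FullPrinted c35Y geo9Y (bg9Y (Matrix (Fin N) (Fin N) ℂ) (specialUnitaryUnits (Fin N)))
      (fun x => (opsYOfRecordV4E N θ Mstar 𝔯 𝔢 𝔴 𝔈 x).Ck) inΛY unitDistY
      (fun x => (opsYOfRecordV4E N θ Mstar 𝔯 𝔢 𝔴 𝔈 x).GivenBy3185) (fun x => (opsYOfRecordV4E N θ Mstar 𝔯 𝔢 𝔴 𝔈 x).HasRWExpC) :=
  t315_opsYSectE_of_3185_on N θ Mstar (opsYS349OfRecordV4 N θ Mstar 𝔯 𝔈) (lettersYOfRecordV4 N θ Mstar 𝔯) 𝔢 𝔴 ha₀ hδ₁ hB₁ hmE hmF h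

end Record

/-! ## §6 THE HONESTY GUARD: at def-Y's FLAT Sect. E letters the displayed (3.185)-side hypotheses are inhabited by the typing alone -/

section FlatGuard

open B9Thm315WholeBlocksRect (blockCLM₂ blockCLM₂_eq_blockCLM range_one rowMass_one_le colMass_one_le norm_blockCLM_sec_sandwich_le)

variable (x : MemberY d ℓ hd hL b₀ b₁ Mstar) (𝔏 : CovLettersY 𝔸 x)

/-- at the flat letters the left outer factor is `P_Λ·1·P_Λ`. [cite: Balaban1985BackgroundPropagators, (3.185) p.432, bookkeeping] -/
theorem outerLY_flat (U : CfgY 𝔸 x.toKIdx) :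
    outerLY x (sectELettersY_flat 𝔸 x) U = secY 𝔸 (inΛY x) * (1 : Module.End ℂ (IBondY x.toKIdx → 𝔸)) * secY 𝔸 (inΛY x) := by
  show secΛY 𝔸 x * (1 + (0 : (SiteY x.toKIdx → 𝔸) →ₗ[ℂ] (IBondY x.toKIdx → 𝔸)) ∘ₗ (0 : (IBondY x.toKIdx → 𝔸) →ₗ[ℂ] (SiteY x.toKIdx → 𝔸))) *
    secΛY 𝔸 x = _
  rw [LinearMap.zero_comp, add_zero]
  rfl

/-- … and so is the right outer factor. [cite: Balaban1985BackgroundPropagators, (3.185) p.432, bookkeeping] -/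
theorem outerRY_flat (U : CfgY 𝔸 x.toKIdx) :
    outerRY x (sectELettersY_flat 𝔸 x) U = secY 𝔸 (inΛY x) * (1 : Module.End ℂ (IBondY x.toKIdx → 𝔸)) * secY 𝔸 (inΛY x) := by
  show secΛY 𝔸 x * (1 + (0 : (SiteY x.toKIdx → 𝔸) →ₗ[ℂ] (IBondY x.toKIdx → 𝔸)) ∘ₗ (0 : (IBondY x.toKIdx → 𝔸) →ₗ[ℂ] (SiteY x.toKIdx → 𝔸))) *
    secΛY 𝔸 x = _
  rw [LinearMap.zero_comp, add_zero]
  rfl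

/-- at the flat letters the middle factor vanishes (`G̃₂ := 0`). [cite: Balaban1985BackgroundPropagators, (3.186) p.432, bookkeeping] -/
theorem midSY_flat (U : CfgY 𝔸 x.toKIdx) : midSY x 𝔏 (sectELettersY_flat 𝔸 x) U = 0 := by
  show QY x.toKIdx 𝔏.parB U ∘ₗ (0 : (FBondY x.toKIdx → 𝔸) →ₗ[ℂ] (FBondY x.toKIdx → 𝔸)) ∘ₗ QsY x.toKIdx 𝔏.parB U = 0
  rw [LinearMap.zero_comp, LinearMap.comp_zero]

variable [FiniteDimensional ℂ 𝔸]

/-- blocks of `P_Λ·1·P_Λ`: range `0`, row and column mass `≤ 1`. [cite: Balaban1985BackgroundPropagators, (3.185) p.432, bookkeeping] -/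
theorem blockCLM_sec_one_sec (p q : IBondY x.toKIdx) :
    (blockCLM (secY 𝔸 (inΛY x) * (1 : Module.End ℂ (IBondY x.toKIdx → 𝔸)) * secY 𝔸 (inΛY x)) p q ≠ 0 → unitDistY x p q ≤ 0) ∧
      (∑ q', ‖blockCLM (secY 𝔸 (inΛY x) * (1 : Module.End ℂ (IBondY x.toKIdx → 𝔸)) * secY 𝔸 (inΛY x)) p q'‖ ≤ 1) ∧
      (∑ p', ‖blockCLM (secY 𝔸 (inΛY x) * (1 : Module.End ℂ (IBondY x.toKIdx → 𝔸)) * secY 𝔸 (inΛY x)) p' q‖ ≤ 1) := by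
  refine ⟨fun h => ?_, ?_, ?_⟩
  · have h1 := blockCLM_ne_zero_of_sec_sandwich (inΛY x) (1 : Module.End ℂ (IBondY x.toKIdx → 𝔸)) h
    rw [← blockCLM₂_eq_blockCLM] at h1
    exact range_one (isPseudoDist_unitDistY x) id p q h1
  · calc ∑ q', ‖blockCLM (secY 𝔸 (inΛY x) * (1 : Module.End ℂ (IBondY x.toKIdx → 𝔸)) * secY 𝔸 (inΛY x)) p q'‖
        ≤ ∑ q', ‖blockCLM₂ (1 : Module.End ℂ (IBondY x.toKIdx → 𝔸)) p q'‖ :=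
          Finset.sum_le_sum fun q' _ => norm_blockCLM_sec_sandwich_le (inΛY x) (1 : Module.End ℂ (IBondY x.toKIdx → 𝔸)) p q'
      _ ≤ 1 := rowMass_one_le p
  · calc ∑ p', ‖blockCLM (secY 𝔸 (inΛY x) * (1 : Module.End ℂ (IBondY x.toKIdx → 𝔸)) * secY 𝔸 (inΛY x)) p' q‖
        ≤ ∑ p', ‖blockCLM₂ (1 : Module.End ℂ (IBondY x.toKIdx → 𝔸)) p' q‖ :=
          Finset.sum_le_sum fun p' _ => norm_blockCLM_sec_sandwich_le (inΛY x) (1 : Module.End ℂ (IBondY x.toKIdx → 𝔸)) p' q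
      _ ≤ 1 := colMass_one_le q

/-- **at the flat Sect. E letters the outer locality holds for every `r ≥ 0`, `m_E, m_F ≥ 1` and every `U`** (inhabitation by the typing).
[cite: Balaban1985BackgroundPropagators, (3.169) p.430, bookkeeping] -/
theorem localOuterY_flat (U : CfgY 𝔸 x.toKIdx) {r mE mF : ℝ} (hr : 0 ≤ r) (hmE : 1 ≤ mE) (hmF : 1 ≤ mF) :
    LocalOuterY x (sectELettersY_flat 𝔸 x) r mE mF U := by
  refine ⟨fun p q h => ?_, fun p => ?_, fun q p h => ?_, fun p => ?_⟩
  · rw [outerLY_flat] at h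
    exact ((blockCLM_sec_one_sec x p q).1 h).trans hr
  · rw [outerLY_flat]; exact ((blockCLM_sec_one_sec x p p).2.1).trans hmE
  · rw [outerRY_flat] at h
    exact ((blockCLM_sec_one_sec x q p).1 h).trans hr
  · rw [outerRY_flat]; exact ((blockCLM_sec_one_sec x p p).2.2).trans hmF

/-- **at the flat Sect. E letters the Λ-restricted middle decay holds for every `B₁ ≥ 0`, `δ`, `U`** (the middle factor is `0`).
[cite: Balaban1985BackgroundPropagators, (3.186) p.432, bookkeeping] -/
theorem decayMidOnY_flat (U : CfgY 𝔸 x.toKIdx) {B₁ : ℝ} (hB₁ : 0 ≤ B₁) (δ : ℝ) : DecayMidOnY x 𝔏 (sectELettersY_flat 𝔸 x) B₁ U δ := by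
  intro p q _ _
  rw [midSY_flat]
  have h0 : blockCLM (0 : Module.End ℂ (IBondY x.toKIdx → 𝔸)) p q = 0 := by ext a; rfl
  rw [h0, norm_zero]
  positivity

/-- ★ **THE HONESTY GUARD**: at def-Y's FLAT Sect. E letters `sectELettersY_flat` the three (3.185)-side conjuncts displayed by `thm315FullPrinted_sectE_of_3185_on` —
the (3.185) identity (`givenBy3185Y_flat`), the outer locality and the Λ-restricted middle decay — hold for EVERY `U` (here `r = 0`, `m_E = m_F = 1`, any `B₁ ≥ 0`): the
schema is inhabited by the typing, and (as the kernel `CkY` is `0` there) carries content exactly with GENUINE Sect. E letters — the same guard as def-Y's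
`t315_opsYOfRecordES_flat`. [cite: Balaban1985BackgroundPropagators, Thm 3.15 (3.185)–(3.187) p.432, bookkeeping] -/
theorem hyps3185_flat (U : CfgY 𝔸 x.toKIdx) {B₁ : ℝ} (hB₁ : 0 ≤ B₁) (δ : ℝ) :
    givenBy3185Y x 𝔏 (sectELettersY_flat 𝔸 x) U ∧ LocalOuterY x (sectELettersY_flat 𝔸 x) 0 1 1 U ∧
      DecayMidOnY x 𝔏 (sectELettersY_flat 𝔸 x) B₁ U δ :=
  ⟨givenBy3185Y_flat x 𝔏 U, localOuterY_flat x U le_rfl le_rfl le_rfl, decayMidOnY_flat x 𝔏 U hB₁ δ⟩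

end FlatGuard

end Literature.MathematicalPhysics.QuantumFieldTheory.Balaban1983to89.B9Thm315WholeSectERepOn

end
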